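import Literature.MathematicalPhysics.QuantumFieldTheory.Balaban1983to89.B2Eq352TowerVolumeBound

/-!
# Bałaban, (Higgs)₂,₃ quantum fields in a finite volume II [Balaban1982Higgs2] — Sect. 3.C pp. 592–594:
# the cubes `𝒞_k` of (3.43)–(3.45) and the volume of `Λ₀^{(k)c}` BY CUBE COUNTS, (3.50)/(3.52), for the
# constructed tower of regions

statement-level skeleton of published theorems with citation tags; proofs where landed; nothing here is a claim about
the Yang–Mills mass gap.  Concrete (Higgs)₂,₃ model file of the `lit-balaban` skeleton (unit `lit-balaban-typer`,
gen 9; v1 p274008, v1.1 = §5 appended + this docstring); everything below is PROVED (no `sorry`, no new `Prop` carrier).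

## What is printed

p. 592: *"Let us consider a regular partition of T₁ into a lattice of cubes, each cube is a sum of large blocks and a
length of its side is bigger r(ε), and less 2r(ε). Let us define 𝒞₀ as the set of the cubes having common points with
Λ₀^{(0)c}. Thus Λ₀^{(0)c} ⊂ ⋃_{□∈𝒞₀} □ = ∪𝒞₀ (3.43) … |𝒞₀| ≤ 3^d(|P_v^{(0)}| + … + |R_s^{(0)}|) (3.44) … In a similar
way we divide T₁^{(k)} into a regular lattice of cubes consisting of large blocks and having sides of length bigger than
r(L^kε) and less than 2r(L^kε). We define 𝒞_k as the set of these cubes, which have the common points with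
Λ₇^{(k−1)′} ∩ Λ₀^{(k)c} … |𝒞_k| ≤ 3^d(|P_v^{(k)}| + … + |R_s^{(k)}|) (3.45)."*  p. 593: *"The sets 𝒞_k, more exactly
their numbers of elements |𝒞_k|, will be just these basic quantities … Now we will express |Λ₀^{(k)c}| by the help of
|𝒞_k|. We will construct a sequence 𝒟₀, 𝒟₁, …, 𝒟_{K−1} of families of cubes with the properties that Λ₀^{(k)c} is
contained in the sum of cubes of the family 𝒟_k"*, (3.48)–(3.50); p. 594: *"|Λ₀^{(k)c}| ≤ O(1) r(L^kε)^d (|𝒞₀| + … +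
|𝒞_k|)"* (3.52).

## What this file does (mechanism level, for the regions CONSTRUCTED in `B2Eq243RegionsTower`)

`B2Eq350TowerVolume`/`B2Eq352TowerVolumeBound` proved (3.48)–(3.52) for the constructed tower with ONE enlarged cube per
large-field POINT of the steps `l ≤ k`.  The print charges one enlarged cube per CUBE of `𝒞_l`; this file makes that
conversion:

* §1 the whole construction (2.7)–(2.8)/(2.55)/(2.43) is MONOTONE in its data: enlarging the (2.7) complements and the
  radii at the levels `≤ k` shrinks every `Λ_i^{(j)}`, `j ≤ k` (windows included, inductively) — `towerRegion_anti`;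
  and the (2.7) complement of large-field data `bad` with radius `r` lies in that of any `bad'` with radius `r + t` as
  soon as every point of `bad` is within `t` of `bad'` — `regionCompl_zero_subset_of_near`;
* §2 the cubes: `cubeOf q x` = the cube of `q^d` large blocks containing `x` (large-block labels divided by `q`); two
  points of one cube are at distance `≤ qLM − 1` (`tdist_le_of_cubeOf_eq`); one representative large-field point per
  cube (`cubeReps`, `card_cubeReps_le`, `exists_cubeRep_near`); the printed side condition: with
  `q_l = ⌊r_l/(LM)⌋ + 1` the side `q_l·LM` is `> r_l` and `≤ r_l + LM` (`lt_side`, `side_le`; `< 2r_l` when `LM < r_l`,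
  `side_lt_two_mul`);
* §3 the count: the tower built from the representatives with radii `2r_l + LM` has SMALLER regions (§1), and
  `B2Eq350TowerVolume.card_compl_towerRegion_le` / `B2Eq352TowerVolumeBound.card_compl_towerRegion_le_352` applied to
  it give `|Λ_i^{(k)c}| ≤ Σ_{l≤k} nCubes_l · (2⌊rad⌋ + 1)^d` and the (3.52) shape
  `|Λ_i^{(k)c}| ≤ (coef352 · S351 · (2r_k + LM))^d · Σ_{l≤k} nCubes_l`, where `nCubes_l` = the number of cubes of
  `T₁^{(l)}` CONTAINING a large-field point of step `l` (`card_compl_towerRegion_le_nCubes`,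
  `card_compl_towerRegion_le_352_nCubes`, and with the printed radii `r(L^mε)` and `D` explicit:
  `card_compl_towerRegion_le_352_nCubes_rFn` — the body of r14's `B2Sect3C.Bound352` for these regions);
* §4 `nCubes_l ≤ |bad_l|` (cf. (3.44)/(3.45): at most one cube per element; `nCubes_le_card`) and `nCubes_l ≤ |𝒞_l|`
  with `𝒞_l` = the cubes meeting `window_l ∩ Λ₀^{(l)c}` in cube-label form (`cover`), as soon as the large-field
  points of step `l` lie in the step's window (`nCubes_le_card_cover`; (3.43) is `cubeOf_mem_cover`);
* §5 (v1.1) the (3.45) reading of `𝒞_l`: the cubes containing a large block that lies INSIDE the window and not in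
  `Λ₀^{(l)}` (`inA`, `coverIn ⊆ cover`); such a block is at distance `< r_l` from a large-field point
  (`exists_bad_near_of_mem_inA` / `exists_bad_near_of_mem_coverIn` — the printed premise of (3.45)); and the covering
  charged to THESE cubes, with radii `r_l + LM` and no hypothesis on the large-field points:
  `card_compl_towerRegion_le_coverIn`, `card_compl_towerRegion_le_352_coverIn`, `…_coverIn_rFn` (seed inclusion
  `relSeed_subset_relSeed_srcIn` + `towerRegion_anti_seed`).

## Modelling notes (honest divergences)

* The cubes are defined by integer division of the large-block labels `0 ≤ b_μ < 2L^{K−l−1}L′_μ` by `q_l`; this is the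
  printed *"regular partition … into a lattice of cubes consisting of large blocks"* when `q_l` divides the label
  counts, otherwise the cubes at the label seam are truncated (side `< q_l LM`).  Only `side ≤ q_l LM` is used below, so
  every statement holds in either case.
* Two readings of `𝒞_l`.  `cover` (§4) takes the complement `Λ₀^{(l)c}` in `T₁^{(l)}`: it also contains cubes meeting
  large blocks of `T₁^{(l)}` that straddle `∂Λ₇^{(l−1)′}` (a union of `M`-cubes, not of `LM`-cubes), for which the printed
  premise of (3.45) need not hold.  `coverIn` (§5) takes the complement inside the family of large blocks *"contained in
  Λ₇^{(l−1)′}"* of the p. 570 definition of `Λ₀^{(l)}`: for its cubes the premise of (3.45) holds as printed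
  (`exists_bad_near_of_mem_coverIn`).  (3.50)/(3.52) are proved for `nCubes`, `cover` and `coverIn`; the straddling
  blocks are absorbed by the lower-level terms of `B2Eq350TowerVolume`'s recursion (the print's corridors of `𝒟_{l−1}`),
  and the `3^d` of (3.44)/(3.45) is not used here (`nCubes_le_card`).
* Packaging a `B2.Run`/`B2Sect3C.CData` (r14) whose `Seq` ranges over the realizable region sequences, with
  `nC_l := |coverIn_l|` (a function of the sequence), is left to the owner of the (3.42) chain; this file supplies the
  inequality `vol0c ≤ D · r(L^kε)^d · Σ_{l≤k} nC_l` and the (3.45) premise for these cubes.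

Cross-references: rows B2.Eq3.47 ((3.43)–(3.45), (3.50), (3.52) members), B2.Eq2.55, B2.Eq2.43 of the cell's SKELETON;
r14 `B2Sect3C` (`Bound350`, `Bound352`, `S351`), p23 `B2Ineq352CorridorBound` (ℤ^d corridor model).  NOT summit
progress.  Unit `lit-balaban-typer` gen 9 (literature-prover-lit-balaban-typer-g9-0).
-/

open scoped BigOperators

namespace Literature.MathematicalPhysics.QuantumFieldTheory.Balaban1983to89.B2Eq345TowerCubes

open HiggsLattice HiggsRescaling B2LargeField B2Eq28RegionsConcrete B2Eq255RegionsWindow B2Eq243RegionsTower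
open B2Eq350TowerVolume B2Eq352TowerVolumeBound
open B2Eq324NestedRegions (prime mem_prime)
open B1Ineq234LevelZero (tdist_comm tdist_triangle_real)
open B2Sect3C (S351 one_le_S351)

noncomputable section

variable {P : HiggsLattice.Params}

/-! ## §1 Monotonicity of the construction (2.7)–(2.8), (2.55), (2.43) in its data -/

section Mono

variable {k : ℕ}

/-- (2.8) iterated is monotone in the seed complement AND in the radius. [cite: Balaban1982Higgs2, (2.8) p.558] -/
theorem grow_mono_radius {S₀ S₁ : Set (HiggsLattice.Site P k)} (hS : S₀ ⊆ S₁) {r r' : ℝ} (hr : r ≤ r') :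
    ∀ i : ℕ, grow S₀ r i ⊆ grow S₁ r' i
  | 0 => hS
  | i + 1 => fun x hx => by
      obtain ⟨y, hy, hd⟩ := mem_grow_succ.mp hx
      exact mem_grow_succ.mpr ⟨y, grow_mono_radius hS hr i hy, hd.trans hr⟩

/-- The (2.7) complement `Λ₀ᶜ` grows with the large-field set and with the radius. [cite: Balaban1982Higgs2, (2.7) p.558] -/
theorem regionCompl_zero_mono {bad bad' : Set (HiggsLattice.Site P k)} (hb : bad ⊆ bad') {r r' : ℝ} (hr : r ≤ r') :
    regionCompl bad r 0 ⊆ regionCompl bad' r' 0 := fun x hx => by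
  obtain ⟨z, hz, hd⟩ := mem_regionCompl_zero.mp hx
  exact mem_regionCompl_zero.mpr ⟨z, hb hz, hd.trans_le hr⟩

/-- **Approximate large-field data.** If every point of `bad` is within `t` of a point of `bad'`, then the (2.7)
complement for `bad` with radius `r` lies in the (2.7) complement for `bad'` with radius `r + t` (triangle inequality
through a point of the large block realising `dist(block, z)`). [cite: Balaban1982Higgs2, (2.7) p.558] -/
theorem regionCompl_zero_subset_of_near {bad bad' : Set (HiggsLattice.Site P k)} {r t : ℝ}
    (h : ∀ z ∈ bad, ∃ z' ∈ bad', (HiggsLattice.Site.tdist z z' : ℝ) ≤ t) :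
    regionCompl bad r 0 ⊆ regionCompl bad' (r + t) 0 := fun x hx => by
  obtain ⟨z, hz, hd⟩ := mem_regionCompl_zero.mp hx
  obtain ⟨z', hz', hzz'⟩ := h z hz
  obtain ⟨x', hx', hxz⟩ := exists_lbDist_eq x z
  refine mem_regionCompl_zero.mpr ⟨z', hz', ?_⟩
  calc lbDist x z' ≤ (HiggsLattice.Site.tdist x' z' : ℝ) := lbDist_le_of_mem hx' z'
    _ ≤ (HiggsLattice.Site.tdist x' z : ℝ) + (HiggsLattice.Site.tdist z z' : ℝ) := tdist_triangle_real x' z z'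
    _ < r + t := by rw [hxz]; exact add_lt_add_of_lt_of_le hd hzz'

variable {W W' : Finset (HiggsLattice.Site P k)} {bad bad' : Set (HiggsLattice.Site P k)} {r r' : ℝ}

/-- The p. 570 seed `Λ₀^{(k)c}` grows when the window shrinks and the (2.7) complement grows. [cite: Balaban1982Higgs2, (2.55) p.570] -/
theorem relSeed_mono (hW : W' ⊆ W) (h0 : regionCompl bad r 0 ⊆ regionCompl bad' r' 0) :
    relSeed W bad r ⊆ relSeed W' bad' r' := fun x hx => by
  rcases mem_relSeed.mp hx with h | h
  · exact mem_relSeed.mpr (Or.inl fun h' => h (h'.trans hW))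
  · exact mem_relSeed.mpr (Or.inr (h0 h))

/-- Hence every `Λ_i^{(k)c}` grows (smaller window, larger (2.7) complement, larger radius). [cite: Balaban1982Higgs2, (2.55) p.570] -/
theorem regionRelCompl_mono (hW : W' ⊆ W) (h0 : regionCompl bad r 0 ⊆ regionCompl bad' r' 0) (hr : r ≤ r') (i : ℕ) :
    regionRelCompl W bad r i ⊆ regionRelCompl W' bad' r' i :=
  grow_mono_radius (relSeed_mono hW h0) hr i

/-- … and every `Λ_i^{(k)}` shrinks. [cite: Balaban1982Higgs2, (2.55) p.570] -/
theorem regionRel_anti (hW : W' ⊆ W) (h0 : regionCompl bad r 0 ⊆ regionCompl bad' r' 0) (hr : r ≤ r') (i : ℕ) :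
    regionRel W' bad' r' i ⊆ regionRel W bad r i := fun x hx => by
  rw [mem_regionRel] at hx ⊢
  exact fun h => hx (regionRelCompl_mono hW h0 hr i h)

/-- The operation `′` of (3.22) is monotone. [cite: Balaban1982Higgs2, (3.22) p.588] -/
theorem prime_mono {Λ Λ' : Finset (HiggsLattice.Site P k)} (h : Λ' ⊆ Λ) : prime Λ' ⊆ prime Λ := fun y hy => by
  rw [mem_prime] at hy ⊢
  exact fun x hx => h (hy x hx)

end Mono

section TowerMono

variable {bad bad' : (j : ℕ) → Set (HiggsLattice.Site P j)} {r r' : ℕ → ℝ}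

/-- **The tower of all the steps is antitone in its data**: if at every level `j ≤ k` the (2.7) complement of
`(bad' j, r' j)` contains that of `(bad j, r j)` and `r j ≤ r' j`, then `Λ_i^{(k)}(bad', r') ⊆ Λ_i^{(k)}(bad, r)` for
every `i` — by induction on `k`, the windows `Λ₇^{(k−1)′}` shrinking along (`prime_mono`). [cite: Balaban1982Higgs2, (2.43) p.566] -/
theorem towerRegion_anti :
    ∀ (k : ℕ), (∀ j, j ≤ k → regionCompl (bad j) (r j) 0 ⊆ regionCompl (bad' j) (r' j) 0) →
      (∀ j, j ≤ k → r j ≤ r' j) → ∀ i : ℕ, towerRegion bad' r' k i ⊆ towerRegion bad r k i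
  | 0, h0, hr, i => regionRel_anti (Finset.Subset.refl _) (h0 0 le_rfl) (hr 0 le_rfl) i
  | k + 1, h0, hr, i => by
      rw [towerRegion_succ, towerRegion_succ]
      exact regionRel_anti (prime_mono (towerRegion_anti k (fun j hj => h0 j (Nat.le_succ_of_le hj))
        (fun j hj => hr j (Nat.le_succ_of_le hj)) 7)) (h0 (k + 1) le_rfl) (hr (k + 1) le_rfl) i

end TowerMono

/-! ## §2 The cubes of p. 592: `q^d` large blocks, and one representative large-field point per cube -/

section Cubes

variable {k : ℕ}

/-- **The cube of `x`** in the partition of `T₁^{(k)}` into cubes of `q^d` large blocks (*"a regular partition of T₁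
into a lattice of cubes, each cube is a sum of large blocks"*): the large-block labels of `x` divided by `q`.
[cite: Balaban1982Higgs2, (3.43) p.592] -/
def cubeOf (q : ℕ) (x : HiggsLattice.Site P k) : Fin P.d → ℕ := fun μ => ((largeBlockOf x) μ).val / q

/-- In coordinates: the label of the cube of `x` in direction `μ` is `x_μ / (LMq)`. [cite: Balaban1982Higgs2, (3.43) p.592] -/
theorem cubeOf_apply (q : ℕ) (x : HiggsLattice.Site P k) (μ : Fin P.d) :
    cubeOf q x μ = (x μ).val / (P.L * P.M * q) := by
  unfold cubeOf
  rw [largeBlockOf_val, Nat.div_div_eq_div_mul]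

/-- *"each cube is a sum of large blocks"*: the cube depends only on the large block. [cite: Balaban1982Higgs2, (3.43) p.592] -/
theorem cubeOf_largeBlockOf_congr (q : ℕ) {x x' : HiggsLattice.Site P k} (h : largeBlockOf x = largeBlockOf x') :
    cubeOf q x = cubeOf q x' := by
  unfold cubeOf
  rw [h]

/-- Naturals with the same quotient by `n > 0` differ by at most `n − 1`. [folklore] -/
private theorem sub_le_of_div_eq {a b n : ℕ} (hn : 0 < n) (h : a / n = b / n) : a - b ≤ n - 1 := by
  have h1 : a < a / n * n + n := Nat.lt_div_mul_add hn
  have h2 : b / n * n ≤ b := Nat.div_mul_le_self b n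
  rw [h] at h1
  omega

/-- **A cube of `q^d` large blocks has diameter `≤ qLM − 1`** in the distance (1.3) (lattice units of `T^{(k)}`).
[cite: Balaban1982Higgs2, (3.43) p.592] -/
theorem tdist_le_of_cubeOf_eq {q : ℕ} (hq : 0 < q) {x y : HiggsLattice.Site P k} (h : cubeOf q x = cubeOf q y) :
    HiggsLattice.Site.tdist x y ≤ P.L * P.M * q - 1 := by
  have hn : 0 < P.L * P.M * q := Nat.mul_pos (Nat.mul_pos P.hL P.hM) hq
  unfold HiggsLattice.Site.tdist
  refine Finset.sup_le fun μ _ => ?_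
  have hμ : (x μ).val / (P.L * P.M * q) = (y μ).val / (P.L * P.M * q) := by
    rw [← cubeOf_apply, ← cubeOf_apply, h]
  by_cases hle : (y μ).val ≤ (x μ).val
  · calc min (x μ - y μ).val (y μ - x μ).val ≤ (x μ - y μ).val := min_le_left _ _
      _ = (x μ).val - (y μ).val := ZMod.val_sub hle
      _ ≤ P.L * P.M * q - 1 := sub_le_of_div_eq hn hμ
  · have hle' : (x μ).val ≤ (y μ).val := (not_le.mp hle).le
    calc min (x μ - y μ).val (y μ - x μ).val ≤ (y μ - x μ).val := min_le_right _ _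
      _ = (y μ).val - (x μ).val := ZMod.val_sub hle'
      _ ≤ P.L * P.M * q - 1 := sub_le_of_div_eq hn hμ.symm

/-- The same in real form. [cite: Balaban1982Higgs2, (3.43) p.592] -/
theorem tdist_le_of_cubeOf_eq_real {q : ℕ} (hq : 0 < q) {x y : HiggsLattice.Site P k} (h : cubeOf q x = cubeOf q y) :
    (HiggsLattice.Site.tdist x y : ℝ) ≤ (P.L : ℝ) * P.M * q - 1 := by
  have h1 := tdist_le_of_cubeOf_eq hq h
  have hn : 1 ≤ P.L * P.M * q := Nat.mul_pos (Nat.mul_pos P.hL P.hM) hq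
  have : ((P.L * P.M * q - 1 : ℕ) : ℝ) = (P.L : ℝ) * P.M * q - 1 := by
    rw [Nat.cast_sub hn, Nat.cast_mul, Nat.cast_mul, Nat.cast_one]
  rw [← this]
  exact_mod_cast h1

open Classical in
/-- A representative point of `S` in the cube with label `c` (a junk value if the cube does not meet `S`): the print's
*"to every element … we assign a cube □ having a common point with this element"*, read backwards.
[cite: Balaban1982Higgs2, (3.44) p.592] -/
def cubeRep (q : ℕ) (S : Finset (HiggsLattice.Site P k)) (c : Fin P.d → ℕ) : HiggsLattice.Site P k :=
  if h : ∃ z ∈ S, cubeOf q z = c then h.choose else default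

/-- The representative of a cube meeting `S` lies in `S` and in that cube. [cite: Balaban1982Higgs2, (3.44) p.592] -/
theorem cubeRep_spec {q : ℕ} {S : Finset (HiggsLattice.Site P k)} {c : Fin P.d → ℕ} (h : ∃ z ∈ S, cubeOf q z = c) :
    cubeRep q S c ∈ S ∧ cubeOf q (cubeRep q S c) = c := by
  unfold cubeRep
  rw [dif_pos h]
  exact h.choose_spec

/-- **One representative point of `S` per cube meeting `S`.** [cite: Balaban1982Higgs2, (3.44) p.592] -/
def cubeReps (q : ℕ) (S : Finset (HiggsLattice.Site P k)) : Finset (HiggsLattice.Site P k) :=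
  (S.image (cubeOf q)).image (cubeRep q S)

/-- There are at most as many representatives as cubes meeting `S`. [cite: Balaban1982Higgs2, (3.44) p.592] -/
theorem card_cubeReps_le (q : ℕ) (S : Finset (HiggsLattice.Site P k)) :
    (cubeReps q S).card ≤ (S.image (cubeOf q)).card :=
  Finset.card_image_le

/-- The representatives are points of `S`. [cite: Balaban1982Higgs2, (3.44) p.592] -/
theorem cubeReps_subset (q : ℕ) (S : Finset (HiggsLattice.Site P k)) : cubeReps q S ⊆ S := by
  intro z hz
  obtain ⟨c, hc, rfl⟩ := Finset.mem_image.mp hz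
  obtain ⟨w, hw, hwc⟩ := Finset.mem_image.mp hc
  exact (cubeRep_spec ⟨w, hw, hwc⟩).1

/-- Every point of `S` is within `qLM − 1` of the representative of its cube. [cite: Balaban1982Higgs2, (3.44) p.592] -/
theorem exists_cubeRep_near {q : ℕ} (hq : 0 < q) (S : Finset (HiggsLattice.Site P k)) {z : HiggsLattice.Site P k}
    (hz : z ∈ S) : ∃ z' ∈ cubeReps q S, (HiggsLattice.Site.tdist z z' : ℝ) ≤ (P.L : ℝ) * P.M * q - 1 := by
  refine ⟨cubeRep q S (cubeOf q z), Finset.mem_image.mpr ⟨cubeOf q z, Finset.mem_image_of_mem _ hz, rfl⟩, ?_⟩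
  exact tdist_le_of_cubeOf_eq_real hq (cubeRep_spec ⟨z, hz, rfl⟩).2.symm

/-- **The printed size of the cubes**: `q_l = ⌊r_l/(LM)⌋ + 1` large blocks per side, so that the side `q_l·LM` (in
lattice units of `T^{(l)}`) is *"bigger than r(L^lε)"* and at most `r(L^lε) + LM` (*"less than 2r(L^lε)"* once
`LM < r(L^lε)`). [cite: Balaban1982Higgs2, (3.45) p.592] -/
def qOf (P : HiggsLattice.Params) (r : ℕ → ℝ) (l : ℕ) : ℕ := ⌊r l / ((P.L : ℝ) * P.M)⌋₊ + 1

/-- `q_l ≥ 1`. [cite: Balaban1982Higgs2, (3.45) p.592] -/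
theorem qOf_pos (r : ℕ → ℝ) (l : ℕ) : 0 < qOf P r l := Nat.succ_pos _

/-- `LM > 0` as a real number. [cite: Balaban1982Higgs1, (1.17) p.606] -/
theorem LM_pos (P : HiggsLattice.Params) : (0 : ℝ) < (P.L : ℝ) * P.M := by
  have hL : (0 : ℝ) < P.L := by exact_mod_cast P.hL
  have hM : (0 : ℝ) < P.M := by exact_mod_cast P.hM
  exact mul_pos hL hM

/-- The side is *"bigger than r(L^lε)"*: `r_l < q_l·LM`. [cite: Balaban1982Higgs2, (3.45) p.592] -/
theorem lt_side (r : ℕ → ℝ) (l : ℕ) : r l < (P.L : ℝ) * P.M * (qOf P r l : ℝ) := by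
  have hLM := LM_pos P
  have h1 : r l / ((P.L : ℝ) * P.M) < (qOf P r l : ℝ) := by
    unfold qOf
    push_cast
    exact Nat.lt_floor_add_one _
  rw [mul_comm ((P.L : ℝ) * P.M)]
  exact (div_lt_iff₀ hLM).mp h1

/-- The side is at most `r_l + LM` (for `r_l ≥ 0`). [cite: Balaban1982Higgs2, (3.45) p.592] -/
theorem side_le {r : ℕ → ℝ} {l : ℕ} (hr : 0 ≤ r l) : (P.L : ℝ) * P.M * (qOf P r l : ℝ) ≤ r l + (P.L : ℝ) * P.M := by
  have hLM := LM_pos P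
  have h1 : (⌊r l / ((P.L : ℝ) * P.M)⌋₊ : ℝ) ≤ r l / ((P.L : ℝ) * P.M) := Nat.floor_le (div_nonneg hr hLM.le)
  unfold qOf
  push_cast
  calc (P.L : ℝ) * P.M * ((⌊r l / ((P.L : ℝ) * P.M)⌋₊ : ℝ) + 1)
      ≤ (P.L : ℝ) * P.M * (r l / ((P.L : ℝ) * P.M) + 1) := by gcongr
    _ = r l + (P.L : ℝ) * P.M := by rw [mul_add, mul_div_cancel₀ _ hLM.ne', mul_one]

/-- … hence *"less than 2r(L^lε)"* as soon as a large block is smaller than `r(L^lε)`. [cite: Balaban1982Higgs2, (3.45) p.592] -/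
theorem side_lt_two_mul {r : ℕ → ℝ} {l : ℕ} (hr : (P.L : ℝ) * P.M < r l) :
    (P.L : ℝ) * P.M * (qOf P r l : ℝ) < 2 * r l := by
  have := side_le (P := P) (le_of_lt ((LM_pos P).trans hr))
  linarith

end Cubes

/-! ## §3 (3.50)/(3.52) for the constructed regions, by the numbers of cubes containing large-field points -/

section Count

variable {bad : (j : ℕ) → Finset (HiggsLattice.Site P j)} {r : ℕ → ℝ}

/-- **`nCubes_l`**: the number of cubes of `T₁^{(l)}` (of `q_l^d` large blocks) containing a large-field point of step
`l` — this file's reading of *"their numbers of elements |𝒞_k| will be just these basic quantities"* (`≤ |𝒞_l|`, §4).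
[cite: Balaban1982Higgs2, (3.45) p.592] -/
def nCubes (bad : (j : ℕ) → Finset (HiggsLattice.Site P j)) (r : ℕ → ℝ) (l : ℕ) : ℕ :=
  ((bad l).image (cubeOf (qOf P r l))).card

/-- At most one cube per large-field point: `nCubes_l ≤ |bad_l|` (cf. (3.44)/(3.45), without the `3^d`).
[cite: Balaban1982Higgs2, (3.45) p.592] -/
theorem nCubes_le_card (l : ℕ) : nCubes bad r l ≤ (bad l).card := Finset.card_image_le

/-- The representative large-field points of the steps (one per cube). [cite: Balaban1982Higgs2, (3.44) p.592] -/
def badReps (bad : (j : ℕ) → Finset (HiggsLattice.Site P j)) (r : ℕ → ℝ) : (j : ℕ) → Finset (HiggsLattice.Site P j) :=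
  fun l => cubeReps (qOf P r l) (bad l)

/-- `|badReps_l| ≤ nCubes_l`. [cite: Balaban1982Higgs2, (3.45) p.592] -/
theorem card_badReps_le (l : ℕ) : (badReps bad r l).card ≤ nCubes bad r l := card_cubeReps_le _ _

/-- The enlarged radii `2r_l + LM` (≥ `r_l` + the diameter `q_l LM − 1` of a cube) used with the representatives.
[cite: Balaban1982Higgs2, (3.50) p.593] -/
def rPlus (P : HiggsLattice.Params) (r : ℕ → ℝ) (l : ℕ) : ℝ := 2 * r l + (P.L : ℝ) * P.M

/-- `rPlus ≥ 0` when `r_l ≥ 0`. [cite: Balaban1982Higgs2, (3.50) p.593] -/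
theorem rPlus_nonneg {l : ℕ} (hr : 0 ≤ r l) : 0 ≤ rPlus P r l := by
  unfold rPlus
  have := LM_pos P
  linarith

/-- `rPlus ≥ 1` when `r_l ≥ 0` (a large block has at least one site). [cite: Balaban1982Higgs2, (3.50) p.593] -/
theorem one_le_rPlus {l : ℕ} (hr : 0 ≤ r l) : 1 ≤ rPlus P r l := by
  unfold rPlus
  have hL : (1 : ℝ) ≤ P.L := by exact_mod_cast P.hL
  have hM : (1 : ℝ) ≤ P.M := by exact_mod_cast P.hM
  nlinarith

/-- The rescaling hypothesis of (3.51), `r(L^{k−j}ε) ≤ (1 + j log L)^s r(L^kε)`, passes to the enlarged radii.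
[cite: Balaban1982Higgs2, (3.51) p.594] -/
theorem rPlus_rescale {k : ℕ} (hL : 1 < (P.L : ℝ)) {s : ℝ} (hs : 0 ≤ s)
    (hresc : ∀ j, j ≤ k → r (k - j) ≤ (1 + (j : ℝ) * Real.log (P.L : ℝ)) ^ s * r k) :
    ∀ j, j ≤ k → rPlus P r (k - j) ≤ (1 + (j : ℝ) * Real.log (P.L : ℝ)) ^ s * rPlus P r k := by
  intro j hj
  have hlog : 0 < Real.log (P.L : ℝ) := Real.log_pos hL
  have hB : 1 ≤ (1 + (j : ℝ) * Real.log (P.L : ℝ)) ^ s :=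
    Real.one_le_rpow (by nlinarith [(Nat.cast_nonneg j : (0 : ℝ) ≤ j)]) hs
  have hLM := (LM_pos P).le
  have h1 := hresc j hj
  unfold rPlus
  calc 2 * r (k - j) + (P.L : ℝ) * P.M
      ≤ 2 * ((1 + (j : ℝ) * Real.log (P.L : ℝ)) ^ s * r k) + (1 + (j : ℝ) * Real.log (P.L : ℝ)) ^ s * ((P.L : ℝ) * P.M) := by
        refine add_le_add (by linarith) ?_
        nlinarith
    _ = (1 + (j : ℝ) * Real.log (P.L : ℝ)) ^ s * (2 * r k + (P.L : ℝ) * P.M) := by ring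

/-- **The regions of the representatives' tower are smaller**: `Λ_i^{(k)}(badReps, 2r + LM) ⊆ Λ_i^{(k)}(bad, r)`
(§1: every large-field point is within `q_l LM − 1 ≤ r_l + LM` of a representative). [cite: Balaban1982Higgs2, (3.50) p.593] -/
theorem towerRegionF_badReps_subset {k : ℕ} (hr : ∀ j, j ≤ k → 0 ≤ r j) (i : ℕ) :
    towerRegionF (badReps bad r) (rPlus P r) k i ⊆ towerRegionF bad r k i := by
  refine towerRegion_anti k (fun j hj => ?_) (fun j hj => ?_) i
  · refine (regionCompl_zero_subset_of_near (t := (P.L : ℝ) * P.M * (qOf P r j : ℝ) - 1) fun z hz => ?_).trans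
      (regionCompl_zero_mono Set.Subset.rfl ?_)
    · obtain ⟨z', hz', hd⟩ := exists_cubeRep_near (qOf_pos r j) (bad j) (Finset.mem_coe.mp hz)
      exact ⟨z', Finset.mem_coe.mpr hz', hd⟩
    · have := side_le (P := P) (hr j hj)
      unfold rPlus
      linarith
  · have := hr j hj
    have := (LM_pos P).le
    unfold rPlus
    linarith

/-- … so `|Λ_i^{(k)c}(bad, r)| ≤ |Λ_i^{(k)c}(badReps, 2r + LM)|`. [cite: Balaban1982Higgs2, (3.50) p.593] -/
theorem card_compl_le_card_compl_badReps {k : ℕ} (hr : ∀ j, j ≤ k → 0 ≤ r j) (i : ℕ) :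
    ((towerRegionF bad r k i)ᶜ).card ≤ ((towerRegionF (badReps bad r) (rPlus P r) k i)ᶜ).card :=
  Finset.card_le_card (Finset.compl_subset_compl.mpr (towerRegionF_badReps_subset hr i))

/-- **(3.50) for the constructed regions, BY CUBE COUNTS**: `|Λ_i^{(k)c}| ≤ Σ_{l≤k} nCubes_l · (2⌊rad_{k,l,i}⌋ + 1)^d`
(`k ≤ K`), the radii being `B2Eq350TowerVolume.rad` of the enlarged radii `2r + LM` — one enlarged cube of `T₁^{(k)}`
per cube of `T₁^{(l)}` containing a large-field point of step `l`, as in the print's `𝒟_k`.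
[cite: Balaban1982Higgs2, (3.50) p.593] -/
theorem card_compl_towerRegion_le_nCubes {k : ℕ} (hk : k ≤ P.K) (hr : ∀ j, j ≤ k → 0 ≤ r j) (i : ℕ) :
    ((towerRegionF bad r k i)ᶜ).card ≤
      ∑ l ∈ Finset.range (k + 1), nCubes bad r l * (2 * ⌊rad P (rPlus P r) k l i⌋₊ + 1) ^ P.d := by
  refine (card_compl_le_card_compl_badReps hr i).trans ((card_compl_towerRegion_le hk i).trans ?_)
  exact Finset.sum_le_sum fun l _ => Nat.mul_le_mul_right _ (card_badReps_le l)

/-- `coef352 ≥ 0`. [cite: Balaban1982Higgs2, (3.52) p.594] -/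
theorem coef352_nonneg {S : ℝ} (hS : 0 ≤ S) (i : ℕ) : 0 ≤ coef352 P S i := by
  unfold coef352
  have h8 : (0 : ℝ) ≤ max ((i : ℝ) + 1) 8 := le_max_of_le_right (by norm_num)
  have := (LM_pos P).le
  positivity

/-- **(3.52) for the constructed regions, BY CUBE COUNTS, with the O(1) explicit**: for radii `r_n ≥ 0` (`n ≤ k`)
satisfying the rescaling bound of (3.51), `r_{k−j} ≤ (1 + j log L)^s r_k`,
`|Λ_i^{(k)c}| ≤ (coef352_i · (2r_k + LM))^d · Σ_{l≤k} nCubes_l` (`coef352` of `B2Eq352TowerVolumeBound` at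
`S = S351 L s` of r14's `B2Sect3C`). [cite: Balaban1982Higgs2, (3.52) p.594] -/
theorem card_compl_towerRegion_le_352_nCubes {k : ℕ} (hk : k ≤ P.K) (hL : 1 < (P.L : ℝ)) {s : ℝ} (hs : 0 ≤ s)
    (hr : ∀ n, n ≤ k → 0 ≤ r n)
    (hresc : ∀ j, j ≤ k → r (k - j) ≤ (1 + (j : ℝ) * Real.log (P.L : ℝ)) ^ s * r k) (i : ℕ) :
    (((towerRegionF bad r k i)ᶜ).card : ℝ) ≤
      (coef352 P (S351 (P.L : ℝ) s) i * (2 * r k + (P.L : ℝ) * P.M)) ^ P.d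
        * ∑ l ∈ Finset.range (k + 1), (nCubes bad r l : ℝ) := by
  have h1 : (((towerRegionF bad r k i)ᶜ).card : ℝ) ≤ (((towerRegionF (badReps bad r) (rPlus P r) k i)ᶜ).card : ℝ) := by
    exact_mod_cast card_compl_le_card_compl_badReps hr i
  refine h1.trans ((card_compl_towerRegion_le_352 hk hL hs (fun n hn => rPlus_nonneg (hr n hn))
    (one_le_rPlus (hr k le_rfl)) (rPlus_rescale hL hs hresc) i).trans ?_)
  unfold rPlus
  refine mul_le_mul_of_nonneg_left (Finset.sum_le_sum fun l _ => ?_) (pow_nonneg ?_ _)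
  · exact_mod_cast card_badReps_le l
  · refine mul_nonneg (coef352_nonneg (zero_le_one.trans (one_le_S351 (r := s) hL)) i) ?_
    have := hr k le_rfl
    have := (LM_pos P).le
    linarith

/-- **(3.52) with the printed radii `r(L^mε) = R(1 + log(L^mε)⁻¹)^s` and the constant in front of `r(L^kε)^d`**
(`R ≥ 1`, `s ≥ 0`, `L > 1`, `L^kε ≤ 1`, `k ≤ K`): `|Λ_i^{(k)c}| ≤ (coef352_i · (2 + LM))^d · r(L^kε)^d · Σ_{l≤k} nCubes_l`
— the body of r14's `B2Sect3C.Bound352` (`|Λ₀^{(k)c}| ≤ D r(L^kε)^d (|𝒞₀| + … + |𝒞_k|)`) for the constructed regions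
at `i = 0`, with `nC_l := nCubes_l ≤ |𝒞_l|` (§4) and `D = (coef352₀ · (2 + LM))^d`. [cite: Balaban1982Higgs2, (3.52) p.594] -/
theorem card_compl_towerRegion_le_352_nCubes_rFn {ε R s : ℝ} (hε : 0 < ε) (hR : 1 ≤ R) (hs : 0 ≤ s)
    (hL : 1 < (P.L : ℝ)) {k : ℕ} (hk : k ≤ P.K) (hkε : (P.L : ℝ) ^ k * ε ≤ 1) (i : ℕ) :
    (((towerRegionF bad (fun m => B2.rFn R s ((P.L : ℝ) ^ m * ε)) k i)ᶜ).card : ℝ) ≤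
      (coef352 P (S351 (P.L : ℝ) s) i * (2 + (P.L : ℝ) * P.M)) ^ P.d * B2.rFn R s ((P.L : ℝ) ^ k * ε) ^ P.d
        * ∑ l ∈ Finset.range (k + 1), (nCubes bad (fun m => B2.rFn R s ((P.L : ℝ) ^ m * ε)) l : ℝ) := by
  have hL0 : (0 : ℝ) < P.L := by linarith
  have hmono : ∀ n, n ≤ k → (P.L : ℝ) ^ n * ε ≤ 1 := fun n hn =>
    le_trans (mul_le_mul_of_nonneg_right (pow_le_pow_right₀ hL.le hn) hε.le) hkε
  have hrk : 1 ≤ B2.rFn R s ((P.L : ℝ) ^ k * ε) := one_le_rFn hL0 hε hR hs hkε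
  refine (card_compl_towerRegion_le_352_nCubes hk hL hs (fun n hn => rFn_nonneg hL0 hε (by linarith) n (hmono n hn))
    (fun j hj => rFn_rescale_le hL.le hε (by linarith) hs hj hkε) i).trans ?_
  have hsum : 0 ≤ ∑ l ∈ Finset.range (k + 1), (nCubes bad (fun m => B2.rFn R s ((P.L : ℝ) ^ m * ε)) l : ℝ) :=
    Finset.sum_nonneg fun _ _ => Nat.cast_nonneg _
  rw [← mul_pow]
  refine mul_le_mul_of_nonneg_right (pow_le_pow_left₀ ?_ ?_ P.d) hsum
  · refine mul_nonneg (coef352_nonneg (zero_le_one.trans (one_le_S351 (r := s) hL)) i) ?_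
    have := (LM_pos P).le
    linarith
  · have hc := coef352_nonneg (P := P) (zero_le_one.trans (one_le_S351 (r := s) hL)) i
    have hLM := (LM_pos P).le
    rw [mul_assoc]
    refine mul_le_mul_of_nonneg_left ?_ hc
    nlinarith

end Count

/-! ## §4 `nCubes_l` against the number of elements and against the print's `𝒞_l` -/

section Cover

variable {bad : (j : ℕ) → Finset (HiggsLattice.Site P j)} {r : ℕ → ℝ}

/-- The window of step `l + 1` for `Finset`-valued large-field data (`T₁` for `l = 0`, `Λ₇^{(l−1)′}` afterwards).
[cite: Balaban1982Higgs2, (2.55) p.570] -/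
abbrev windowF (bad : (j : ℕ) → Finset (HiggsLattice.Site P j)) (r : ℕ → ℝ) (l : ℕ) :
    Finset (HiggsLattice.Site P l) :=
  window (fun j => (↑(bad j) : Set (HiggsLattice.Site P j))) r l

/-- **`𝒞_l` in cube-label form**: the cubes (of `q_l^d` large blocks) *"which have the common points with
Λ₇^{(l−1)′} ∩ Λ₀^{(l)c}"* (for `l = 0`: with `Λ₀^{(0)c}`). A function of the window and of `Λ₀^{(l)}` only.
[cite: Balaban1982Higgs2, (3.45) p.592] -/
def cover (bad : (j : ℕ) → Finset (HiggsLattice.Site P j)) (r : ℕ → ℝ) (l : ℕ) : Finset (Fin P.d → ℕ) :=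
  (windowF bad r l \ towerRegionF bad r l 0).image (cubeOf (qOf P r l))

/-- (3.43): a point of `window_l ∩ Λ₀^{(l)c}` lies in a cube of `𝒞_l`. [cite: Balaban1982Higgs2, (3.43) p.592] -/
theorem cubeOf_mem_cover {l : ℕ} {x : HiggsLattice.Site P l} (hxW : x ∈ windowF bad r l)
    (hx : x ∉ towerRegionF bad r l 0) : cubeOf (qOf P r l) x ∈ cover bad r l :=
  Finset.mem_image_of_mem _ (Finset.mem_sdiff.mpr ⟨hxW, hx⟩)

/-- The cubes containing large-field points of step `l` belong to `𝒞_l`, as soon as those points lie in the step's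
window (they lie in `Λ₀^{(l)c}` by construction, `r_l > 0`). [cite: Balaban1982Higgs2, (3.45) p.592] -/
theorem image_bad_subset_cover {l : ℕ} (hr : 0 < r l) (hbw : bad l ⊆ windowF bad r l) :
    (bad l).image (cubeOf (qOf P r l)) ⊆ cover bad r l := by
  intro c hc
  obtain ⟨z, hz, rfl⟩ := Finset.mem_image.mp hc
  exact cubeOf_mem_cover (hbw hz)
    (not_mem_towerRegion_of_bad (bad := fun j => (↑(bad j) : Set (HiggsLattice.Site P j))) hr 0
      (Finset.mem_coe.mpr hz))

/-- **`nCubes_l ≤ |𝒞_l|`** under the same proviso. [cite: Balaban1982Higgs2, (3.45) p.592] -/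
theorem nCubes_le_card_cover {l : ℕ} (hr : 0 < r l) (hbw : bad l ⊆ windowF bad r l) :
    nCubes bad r l ≤ (cover bad r l).card :=
  Finset.card_le_card (image_bad_subset_cover hr hbw)

/-- At the first step the proviso is empty (the window is `T₁`): `nCubes_0 ≤ |𝒞₀|`. [cite: Balaban1982Higgs2, (3.44) p.592] -/
theorem nCubes_zero_le_card_cover (hr : 0 < r 0) : nCubes bad r 0 ≤ (cover bad r 0).card :=
  nCubes_le_card_cover hr fun z _ => Finset.mem_univ z

/-- **(3.52) in the print's currency**: with all large-field points of the steps `l ≤ k` inside their windows,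
`|Λ_i^{(k)c}| ≤ (coef352_i · (2r_k + LM))^d · Σ_{l≤k} |𝒞_l|`. [cite: Balaban1982Higgs2, (3.52) p.594] -/
theorem card_compl_towerRegion_le_352_cover {k : ℕ} (hk : k ≤ P.K) (hL : 1 < (P.L : ℝ)) {s : ℝ} (hs : 0 ≤ s)
    (hr : ∀ n, n ≤ k → 0 < r n) (hbw : ∀ l, l ≤ k → bad l ⊆ windowF bad r l)
    (hresc : ∀ j, j ≤ k → r (k - j) ≤ (1 + (j : ℝ) * Real.log (P.L : ℝ)) ^ s * r k) (i : ℕ) :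
    (((towerRegionF bad r k i)ᶜ).card : ℝ) ≤
      (coef352 P (S351 (P.L : ℝ) s) i * (2 * r k + (P.L : ℝ) * P.M)) ^ P.d
        * ∑ l ∈ Finset.range (k + 1), ((cover bad r l).card : ℝ) := by
  refine (card_compl_towerRegion_le_352_nCubes hk hL hs (fun n hn => (hr n hn).le) hresc i).trans ?_
  refine mul_le_mul_of_nonneg_left (Finset.sum_le_sum fun l hl => ?_) (pow_nonneg ?_ _)
  · have hl' : l ≤ k := Nat.lt_succ_iff.mp (Finset.mem_range.mp hl)
    exact_mod_cast nCubes_le_card_cover (hr l hl') (hbw l hl')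
  · refine mul_nonneg (coef352_nonneg (zero_le_one.trans (one_le_S351 (r := s) hL)) i) ?_
    have := (hr k le_rfl).le
    have := (LM_pos P).le
    linarith

end Cover

/-! ## §5 `𝒞_l` on the large blocks INSIDE the window (the (3.45) reading), and (3.50)/(3.52) charged to those cubes

p. 570 defines `Λ₀^{(k)}` inside the family of large blocks of `T₁^{(k)}` *"contained in Λ₇^{(k−1)′}"*; read `Λ₀^{(k)c}` of
(3.45) inside the same family: the large blocks contained in the window and NOT in `Λ₀^{(k)}` are exactly those at
distance `< r(L^kε)` from a large-field point (`exists_bad_near_of_mem_inA` — the printed premise of (3.45): *"each large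
block of the lattice T₁^{(k)} contained in Λ₀^{(k)c} and having common points with Λ₇^{(k−1)′} has the distance from the
set P_v^{(k)} ∪ … ∪ R_s^{(k)} less than or equal to r(L^kε)"*).  `coverIn_l` = the cubes containing such a block — a
function of the window and of `Λ₀^{(l)}` only, `⊆ cover_l` — and the covering (3.50)/(3.52) holds with `Σ_l |coverIn_l|`
and the radii `r_l + LM` (§1 with the seed inclusion `relSeed_subset_relSeed_srcIn`: a seed point whose large block
lies inside the window is within a cube of a representative; one whose large block leaves the window is a seed point of
any data). -/

section CoverIn

variable {bad : (j : ℕ) → Finset (HiggsLattice.Site P j)} {r : ℕ → ℝ}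

/-- **`Λ₇^{(l−1)′} ∩ Λ₀^{(l)c}` on large blocks**: the sites of `T₁^{(l)}` whose large block lies inside the window of step
`l` and which are not in `Λ₀^{(l)}`. [cite: Balaban1982Higgs2, (3.45) p.592] -/
def inA (bad : (j : ℕ) → Finset (HiggsLattice.Site P j)) (r : ℕ → ℝ) (l : ℕ) : Finset (HiggsLattice.Site P l) :=
  inLB (windowF bad r l) \ towerRegionF bad r l 0

/-- Membership in `inA`. [cite: Balaban1982Higgs2, (3.45) p.592] -/
theorem mem_inA {l : ℕ} {x : HiggsLattice.Site P l} :
    x ∈ inA bad r l ↔ largeBlock (largeBlockOf x) ⊆ windowF bad r l ∧ x ∉ towerRegionF bad r l 0 := by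
  unfold inA
  rw [Finset.mem_sdiff, mem_inLB]

/-- **The premise of (3.45), as printed**: a large block inside the window and inside `Λ₀^{(l)c}` is at distance
`< r(L^lε)` from a large-field point of the step (the p. 570 definition of `Λ₀^{(l)}`, `B2Eq255RegionsWindow.mem_regionRel_zero`).
[cite: Balaban1982Higgs2, (3.45) p.592] -/
theorem exists_bad_near_of_mem_inA {l : ℕ} {x : HiggsLattice.Site P l} (hx : x ∈ inA bad r l) :
    ∃ z ∈ bad l, lbDist x z < r l := by
  obtain ⟨hW, hx0⟩ := mem_inA.mp hx
  rw [towerRegionF, towerRegion_eq, mem_regionRel_zero] at hx0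
  push Not at hx0
  obtain ⟨z, hz, hlt⟩ := hx0 hW
  exact ⟨z, Finset.mem_coe.mp hz, hlt⟩

/-- **`𝒞_l` in cube-label form, (3.45) reading**: the cubes (of `q_l^d` large blocks) containing a large block of
`Λ₇^{(l−1)′} ∩ Λ₀^{(l)c}`. [cite: Balaban1982Higgs2, (3.45) p.592] -/
def coverIn (bad : (j : ℕ) → Finset (HiggsLattice.Site P j)) (r : ℕ → ℝ) (l : ℕ) : Finset (Fin P.d → ℕ) :=
  (inA bad r l).image (cubeOf (qOf P r l))

/-- Every cube of `coverIn_l` contains a large block inside the window at distance `< r_l` from a large-field point (so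
that the `3^d` cubes around the elements cover `∪𝒞_l`, p. 592). [cite: Balaban1982Higgs2, (3.45) p.592] -/
theorem exists_bad_near_of_mem_coverIn {l : ℕ} {c : Fin P.d → ℕ} (hc : c ∈ coverIn bad r l) :
    ∃ x : HiggsLattice.Site P l, cubeOf (qOf P r l) x = c ∧ largeBlock (largeBlockOf x) ⊆ windowF bad r l ∧
      ∃ z ∈ bad l, lbDist x z < r l := by
  obtain ⟨x, hx, rfl⟩ := Finset.mem_image.mp hc
  exact ⟨x, rfl, (mem_inA.mp hx).1, exists_bad_near_of_mem_inA hx⟩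

/-- `coverIn_l ⊆ cover_l` (a large block inside the window lies in the window). [cite: Balaban1982Higgs2, (3.45) p.592] -/
theorem coverIn_subset_cover (l : ℕ) : coverIn bad r l ⊆ cover bad r l :=
  Finset.image_subset_image (Finset.sdiff_subset_sdiff (inLB_subset _) (Finset.Subset.refl _))

/-- One representative site per cube of `coverIn_l`. [cite: Balaban1982Higgs2, (3.45) p.592] -/
def srcIn (bad : (j : ℕ) → Finset (HiggsLattice.Site P j)) (r : ℕ → ℝ) : (j : ℕ) → Finset (HiggsLattice.Site P j) :=
  fun l => cubeReps (qOf P r l) (inA bad r l)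

/-- `|srcIn_l| ≤ |coverIn_l|`. [cite: Balaban1982Higgs2, (3.45) p.592] -/
theorem card_srcIn_le (l : ℕ) : (srcIn bad r l).card ≤ (coverIn bad r l).card := card_cubeReps_le _ _

/-- The radii `r_l + LM` (`≥` the cube diameter `q_l LM − 1`) used with the representatives. [cite: Balaban1982Higgs2, (3.50) p.593] -/
def rIn (P : HiggsLattice.Params) (r : ℕ → ℝ) (l : ℕ) : ℝ := r l + (P.L : ℝ) * P.M

/-- `r_l ≤ rIn_l`. [cite: Balaban1982Higgs2, (3.50) p.593] -/
theorem le_rIn (r : ℕ → ℝ) (l : ℕ) : r l ≤ rIn P r l := by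
  unfold rIn
  have := (LM_pos P).le
  linarith

/-- `rIn ≥ 1` when `r_l ≥ 0`. [cite: Balaban1982Higgs2, (3.50) p.593] -/
theorem one_le_rIn {l : ℕ} (hr : 0 ≤ r l) : 1 ≤ rIn P r l := by
  unfold rIn
  have hL : (1 : ℝ) ≤ P.L := by exact_mod_cast P.hL
  have hM : (1 : ℝ) ≤ P.M := by exact_mod_cast P.hM
  nlinarith

/-- The (3.51) rescaling hypothesis passes to `rIn`. [cite: Balaban1982Higgs2, (3.51) p.594] -/
theorem rIn_rescale {k : ℕ} (hL : 1 < (P.L : ℝ)) {s : ℝ} (hs : 0 ≤ s)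
    (hresc : ∀ j, j ≤ k → r (k - j) ≤ (1 + (j : ℝ) * Real.log (P.L : ℝ)) ^ s * r k) :
    ∀ j, j ≤ k → rIn P r (k - j) ≤ (1 + (j : ℝ) * Real.log (P.L : ℝ)) ^ s * rIn P r k := by
  intro j hj
  have hlog : 0 < Real.log (P.L : ℝ) := Real.log_pos hL
  have hB : 1 ≤ (1 + (j : ℝ) * Real.log (P.L : ℝ)) ^ s :=
    Real.one_le_rpow (by nlinarith [(Nat.cast_nonneg j : (0 : ℝ) ≤ j)]) hs
  have hLM := (LM_pos P).le
  have h1 := hresc j hj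
  unfold rIn
  calc r (k - j) + (P.L : ℝ) * P.M
      ≤ (1 + (j : ℝ) * Real.log (P.L : ℝ)) ^ s * r k + (1 + (j : ℝ) * Real.log (P.L : ℝ)) ^ s * ((P.L : ℝ) * P.M) := by
        refine add_le_add h1 ?_
        nlinarith
    _ = (1 + (j : ℝ) * Real.log (P.L : ℝ)) ^ s * (r k + (P.L : ℝ) * P.M) := by ring

/-- **The seed inclusion**: a point of the p. 570 seed `Λ₀^{(l)c}` of the data `(bad_l, r_l)` is a seed point of the data
`(srcIn_l, r_l + LM)` in the same window — if its large block lies inside the window it is a point of `inA_l`, within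
`q_l LM − 1 < r_l + LM` of the representative of its cube; otherwise the window clause applies to both.
[cite: Balaban1982Higgs2, (2.55) p.570] -/
theorem relSeed_subset_relSeed_srcIn {l : ℕ} (hr : 0 ≤ r l) :
    relSeed (windowF bad r l) (↑(bad l) : Set (HiggsLattice.Site P l)) (r l) ⊆
      relSeed (windowF bad r l) (↑(srcIn bad r l) : Set (HiggsLattice.Site P l)) (rIn P r l) := by
  intro x hx
  by_cases hW : largeBlock (largeBlockOf x) ⊆ windowF bad r l
  · have hx0 : x ∉ towerRegionF bad r l 0 := by
      rw [towerRegionF, towerRegion_eq]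
      exact not_mem_regionRel.mpr hx
    have hxA : x ∈ inA bad r l := mem_inA.mpr ⟨hW, hx0⟩
    obtain ⟨z', hz', hd⟩ := exists_cubeRep_near (qOf_pos r l) (inA bad r l) hxA
    refine mem_relSeed.mpr (Or.inr (mem_regionCompl_zero.mpr ⟨z', Finset.mem_coe.mpr hz', ?_⟩))
    have hside := side_le (P := P) hr
    calc lbDist x z' ≤ (HiggsLattice.Site.tdist x z' : ℝ) := lbDist_le_tdist x z'
      _ ≤ (P.L : ℝ) * P.M * (qOf P r l : ℝ) - 1 := hd
      _ < rIn P r l := by unfold rIn; linarith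
  · exact mem_relSeed.mpr (Or.inl hW)

/-- `Λ_i^{(k)}` is antitone in the seed (same window) and the radius. [cite: Balaban1982Higgs2, (2.55) p.570] -/
theorem regionRel_anti_seed {k : ℕ} {W : Finset (HiggsLattice.Site P k)} {bd bd' : Set (HiggsLattice.Site P k)}
    {ρ ρ' : ℝ} (hs : relSeed W bd ρ ⊆ relSeed W bd' ρ') (hρ : ρ ≤ ρ') (i : ℕ) :
    regionRel W bd' ρ' i ⊆ regionRel W bd ρ i := fun x hx => by
  rw [mem_regionRel] at hx ⊢
  exact fun h => hx (grow_mono_radius hs hρ i h)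

/-- `Λ_i^{(k)}` is monotone in the window (same data). [cite: Balaban1982Higgs2, (2.55) p.570] -/
theorem regionRel_mono_window {k : ℕ} {W W' : Finset (HiggsLattice.Site P k)} (hW : W' ⊆ W)
    (bd : Set (HiggsLattice.Site P k)) (ρ : ℝ) (i : ℕ) : regionRel W' bd ρ i ⊆ regionRel W bd ρ i :=
  regionRel_anti hW Set.Subset.rfl le_rfl i

/-- **The tower is antitone under seed inclusions**: if at every level `j ≤ k` the seed of `(bad j, r j)` in the window
of the `(bad, r)`-tower lies in the seed of `(bad' j, r' j)` in the same window, and `r j ≤ r' j`, then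
`Λ_i^{(k)}(bad', r') ⊆ Λ_i^{(k)}(bad, r)` (induction on `k`; the windows of the `(bad', r')`-tower are smaller).
[cite: Balaban1982Higgs2, (2.43) p.566] -/
theorem towerRegion_anti_seed {bd bd' : (j : ℕ) → Set (HiggsLattice.Site P j)} {ρ ρ' : ℕ → ℝ} :
    ∀ (k : ℕ), (∀ j, j ≤ k → relSeed (window bd ρ j) (bd j) (ρ j) ⊆ relSeed (window bd ρ j) (bd' j) (ρ' j)) →
      (∀ j, j ≤ k → ρ j ≤ ρ' j) → ∀ i : ℕ, towerRegion bd' ρ' k i ⊆ towerRegion bd ρ k i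
  | 0, hs, hρ, i => regionRel_anti_seed (hs 0 le_rfl) (hρ 0 le_rfl) i
  | k + 1, hs, hρ, i => by
      rw [towerRegion_succ, towerRegion_succ]
      have hW : prime (towerRegion bd' ρ' k 7) ⊆ prime (towerRegion bd ρ k 7) :=
        prime_mono (towerRegion_anti_seed k (fun j hj => hs j (Nat.le_succ_of_le hj))
          (fun j hj => hρ j (Nat.le_succ_of_le hj)) 7)
      exact (regionRel_mono_window hW _ _ i).trans (regionRel_anti_seed (hs (k + 1) le_rfl) (hρ (k + 1) le_rfl) i)

/-- **The regions of the representatives' tower are smaller**: `Λ_i^{(k)}(srcIn, r + LM) ⊆ Λ_i^{(k)}(bad, r)`.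
[cite: Balaban1982Higgs2, (3.50) p.593] -/
theorem towerRegionF_srcIn_subset {k : ℕ} (hr : ∀ j, j ≤ k → 0 ≤ r j) (i : ℕ) :
    towerRegionF (srcIn bad r) (rIn P r) k i ⊆ towerRegionF bad r k i :=
  towerRegion_anti_seed k (fun j hj => relSeed_subset_relSeed_srcIn (hr j hj)) (fun j _ => le_rIn r j) i

/-- **(3.50) for the constructed regions, charged to the cubes of `coverIn`**:
`|Λ_i^{(k)c}| ≤ Σ_{l≤k} |coverIn_l| · (2⌊rad_{k,l,i}⌋ + 1)^d` (`k ≤ K`; radii `rad` of `r + LM`).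
[cite: Balaban1982Higgs2, (3.50) p.593] -/
theorem card_compl_towerRegion_le_coverIn {k : ℕ} (hk : k ≤ P.K) (hr : ∀ j, j ≤ k → 0 ≤ r j) (i : ℕ) :
    ((towerRegionF bad r k i)ᶜ).card ≤
      ∑ l ∈ Finset.range (k + 1), (coverIn bad r l).card * (2 * ⌊rad P (rIn P r) k l i⌋₊ + 1) ^ P.d := by
  refine (Finset.card_le_card (Finset.compl_subset_compl.mpr (towerRegionF_srcIn_subset hr i))).trans ?_
  refine (card_compl_towerRegion_le hk i).trans ?_
  exact Finset.sum_le_sum fun l _ => Nat.mul_le_mul_right _ (card_srcIn_le l)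

/-- **(3.52) for the constructed regions in the print's currency `|𝒞₀| + … + |𝒞_k|` ((3.45) reading), O(1) explicit**:
`|Λ_i^{(k)c}| ≤ (coef352_i · (r_k + LM))^d · Σ_{l≤k} |coverIn_l|` for radii `r_n ≥ 0` (`n ≤ k`) with the (3.51) rescaling
property. [cite: Balaban1982Higgs2, (3.52) p.594] -/
theorem card_compl_towerRegion_le_352_coverIn {k : ℕ} (hk : k ≤ P.K) (hL : 1 < (P.L : ℝ)) {s : ℝ} (hs : 0 ≤ s)
    (hr : ∀ n, n ≤ k → 0 ≤ r n)
    (hresc : ∀ j, j ≤ k → r (k - j) ≤ (1 + (j : ℝ) * Real.log (P.L : ℝ)) ^ s * r k) (i : ℕ) :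
    (((towerRegionF bad r k i)ᶜ).card : ℝ) ≤
      (coef352 P (S351 (P.L : ℝ) s) i * (r k + (P.L : ℝ) * P.M)) ^ P.d
        * ∑ l ∈ Finset.range (k + 1), ((coverIn bad r l).card : ℝ) := by
  have h1 : (((towerRegionF bad r k i)ᶜ).card : ℝ) ≤ (((towerRegionF (srcIn bad r) (rIn P r) k i)ᶜ).card : ℝ) := by
    exact_mod_cast Finset.card_le_card (Finset.compl_subset_compl.mpr (towerRegionF_srcIn_subset hr i))
  refine h1.trans ((card_compl_towerRegion_le_352 hk hL hs (fun n hn => (hr n hn).trans (le_rIn r n))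
    (one_le_rIn (hr k le_rfl)) (rIn_rescale hL hs hresc) i).trans ?_)
  unfold rIn
  refine mul_le_mul_of_nonneg_left (Finset.sum_le_sum fun l _ => ?_) (pow_nonneg ?_ _)
  · exact_mod_cast card_srcIn_le l
  · refine mul_nonneg (coef352_nonneg (zero_le_one.trans (one_le_S351 (r := s) hL)) i) ?_
    have := hr k le_rfl
    have := (LM_pos P).le
    linarith

/-- **(3.52), (3.45) reading, with the printed radii `r(L^mε)`** (`R ≥ 1`, `s ≥ 0`, `L > 1`, `L^kε ≤ 1`, `k ≤ K`):
`|Λ_i^{(k)c}| ≤ (coef352_i · (1 + LM))^d · r(L^kε)^d · Σ_{l≤k} |coverIn_l|` — `B2Sect3C.Bound352`'s body for the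
constructed regions with `nC_l := |coverIn_l|` and `D = (coef352₀ · (1 + LM))^d`. [cite: Balaban1982Higgs2, (3.52) p.594] -/
theorem card_compl_towerRegion_le_352_coverIn_rFn {ε R s : ℝ} (hε : 0 < ε) (hR : 1 ≤ R) (hs : 0 ≤ s)
    (hL : 1 < (P.L : ℝ)) {k : ℕ} (hk : k ≤ P.K) (hkε : (P.L : ℝ) ^ k * ε ≤ 1) (i : ℕ) :
    (((towerRegionF bad (fun m => B2.rFn R s ((P.L : ℝ) ^ m * ε)) k i)ᶜ).card : ℝ) ≤
      (coef352 P (S351 (P.L : ℝ) s) i * (1 + (P.L : ℝ) * P.M)) ^ P.d * B2.rFn R s ((P.L : ℝ) ^ k * ε) ^ P.d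
        * ∑ l ∈ Finset.range (k + 1), ((coverIn bad (fun m => B2.rFn R s ((P.L : ℝ) ^ m * ε)) l).card : ℝ) := by
  have hL0 : (0 : ℝ) < P.L := by linarith
  have hmono : ∀ n, n ≤ k → (P.L : ℝ) ^ n * ε ≤ 1 := fun n hn =>
    le_trans (mul_le_mul_of_nonneg_right (pow_le_pow_right₀ hL.le hn) hε.le) hkε
  have hrk : 1 ≤ B2.rFn R s ((P.L : ℝ) ^ k * ε) := one_le_rFn hL0 hε hR hs hkε
  refine (card_compl_towerRegion_le_352_coverIn hk hL hs
    (fun n hn => rFn_nonneg hL0 hε (by linarith) n (hmono n hn))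
    (fun j hj => rFn_rescale_le hL.le hε (by linarith) hs hj hkε) i).trans ?_
  have hsum : 0 ≤ ∑ l ∈ Finset.range (k + 1),
      ((coverIn bad (fun m => B2.rFn R s ((P.L : ℝ) ^ m * ε)) l).card : ℝ) :=
    Finset.sum_nonneg fun _ _ => Nat.cast_nonneg _
  rw [← mul_pow]
  refine mul_le_mul_of_nonneg_right (pow_le_pow_left₀ ?_ ?_ P.d) hsum
  · refine mul_nonneg (coef352_nonneg (zero_le_one.trans (one_le_S351 (r := s) hL)) i) ?_
    have := (LM_pos P).le
    linarith
  · have hc := coef352_nonneg (P := P) (zero_le_one.trans (one_le_S351 (r := s) hL)) i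
    have hLM := (LM_pos P).le
    rw [mul_assoc]
    refine mul_le_mul_of_nonneg_left ?_ hc
    nlinarith

end CoverIn

end

end Literature.MathematicalPhysics.QuantumFieldTheory.Balaban1983to89.B2Eq345TowerCubes
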